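import Literature.NumberTheory.GelbartRogawski1991.LocalUnitaryUndoubling
import Literature.NumberTheory.GelbartRogawski1991.DoubledWeilRepresentationAssembly
import Literature.NumberTheory.GelbartRogawski1991.DoubledWeilRepresentationLocalFamilyCM
import Literature.NumberTheory.GelbartRogawski1991.UnitaryDualPairLocalReferenceSection
import Literature.NumberTheory.Automorphic.UnitaryGroupDualPairReindex
import Literature.NumberTheory.Automorphic.UnitaryGroupRestrictedProduct
import HarnessLib

/-!
# The finite-adelic `g ↦ g ⊕ 1 : U(𝕍)(𝔸_f) →* U(𝕍 ⊕ −𝕍)(𝔸_f)`, its local components, and the doubled CM unitary group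

Topic `NumberTheory/GelbartRogawski1991`; namespaces `Literature.NumberTheory.GelbartRogawski1991.UnitaryDualPair.LocalSplitting`
(§1–§2, the setting of `LocalUnitaryUndoubling`), `Literature.NumberTheory.Automorphic.UnitaryGroup` (§0) and
`Literature.NumberTheory.GelbartRogawski1991.GRConstruction` (§3–§4, the CM
datum of `DoubledUnitaryGlobalSplittingData`).  KERNEL ONLY: one definition with body (`inlFin`) and theorems; no record, no
named fact, no `sorry`.

[GelbartRogawski1991, §3.1 Prop. 3.1.1 p. 455 L1–3] assembles the global splitting over `G(𝔸_f)` as the product of LOCAL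
splittings `s_v`; by doubling [Kudla1994, §2, Thm. 3.1; HarrisKudlaSweet1996, §1] each `s_v` is the splitting of the DOUBLED
group `U(𝕍 ⊕ −𝕍)(F_v)` restricted along `g ↦ g ⊕ 1` (the tree's `inlLoc`, `LocalUnitaryUndoubling`), while the GLOBAL
undoubling (`DoubledWeilRepresentationUndoubling`, `inlG`) restricts the adelic doubled splitting along `g ↦ g ⊕ 1` on
`U(𝕍)(𝔸)`.  Comparing the two («undoubling commutes with place-assembly») needs the finite-adelic version of the same map
and two bookkeeping identities, supplied here:

* §0 inside `GL_{n+n}(𝔸_E)`: `(1, reindex e₂ (g ⊕ 1)) = reindex e₂ ((1, g) ⊕ 1)` (`ofFinite_reindexGL_blockDiagGL_one`, sibling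
  of the tree's `ofFinite_reindexGL_kroneckerGL`);
* §1 `inlFin hJ hJD : U(J)(𝔸_{F,f}) →* U(J^𝔻)(𝔸_{F,f})`, `g ↦ reindex e₂ (g ⊕ 1)` on `GL_{n+n}(𝔸_E^∞)`, with the SAME
  hypotheses `hJ : J = T₀ ⊗ 1`, `hJD : J^𝔻 = (T₀ ⊕ −T₀) ⊗ 1` as `inlLoc` (membership from `finiteAdelicForm_doubled_eq`),
  with its adelic matrix `(1, g ⊕ 1) = (1, g) ⊕ 1` (`adelicVal_finAdelicToAdelic_inlFin`);
* §2 its LOCAL COMPONENTS are the local maps: `evalPlace v (inlFin g) = inlLoc v (evalPlace v g)` (`evalPlace_inlFin`) — so the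
  place-assembled Weil representation `Ω = ⊗'_v ω_v` of `FiniteAdelicSplittingAssembly` reads `Ω(inlFin g)` factorwise through
  `ω_v ∘ inlLoc`;
* §3 for the CM datum of `GRConstruction` (`𝕍 ⊗ 𝕎` with `J_V = diag dV`, `J_W = diag dW`, enumeration `e`): the element of
  the doubled group `H(𝔸)` at which the undoubled pair splitting is evaluated on finite-adelic points IS the finite-adelic
  doubled element: `inlG (a(1,k) · b(1,u)) = (1, inlFin (finPairEmb (k, u)))` (`inlG_adelicInl_mul_adelicInr_finAdelicToAdelic`),
  typed by the tree's form identities `reindex_kronecker_eq_gram_map` (`reindex e e (diag dV ⊗ₖ diag dW) = gramR ⊗ 1`) and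
  `hermD_eq_map_gramD` (`hermD = (gramR ⊕ −gramR) ⊗ 1`), the same terms as the tree's `undoubleLoc` consumers;
* §4 along a doubled splitting ASSEMBLED from halves (`DoubledWeilRepresentationAssembly.assemble`): `assemble hf ha (1, g_f) = s_f g_f`
  and hence `sD (inlG (a(1,k) · b(1,u))) = s_f (inlFin (finPairEmb (k, u)))` (`assemble_inlG_adelicInl_mul_adelicInr`).

Nothing of [GelbartRogawski1991] is asserted; HC_CM is not mentioned by this file.

## References
* [GelbartRogawski1991] S. Gelbart, J. Rogawski, Invent. Math. 105 (1991), §3.1 p. 454 L21–33, Prop. 3.1.1 p. 455 L1–3.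
* [Kudla1994] S. Kudla, Israel J. Math. 87 (1994), §2, Thm. 3.1.
* [HarrisKudlaSweet1996] M. Harris, S. Kudla, W. Sweet, J. AMS 9 (1996), §1 (1.9)–(1.16).
* [PlatonovRapinchuk1994] V. Platonov, A. Rapinchuk, Algebraic Groups and Number Theory (1994), §5.1.

## Provenance

Written for the Hodge/COR-CM transposition lane (item (vi), CARRIERS-PLAN row 9 residual (ρ1), RHO1-HFAC-PLAN v1 §3 leaf
(H3-L2)), pub-hodgecm2 pinning seat pin-3.
-/

set_option autoImplicit false

noncomputable section

open scoped Matrix Kronecker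
open NumberField IsDedekindDomain
open Literature.NumberTheory.Automorphic

/-! ## §0 `(1, reindex e₂ (g ⊕ 1)) = reindex e₂ ((1, g) ⊕ 1)` in `GL_{n+n}(𝔸_E)` -/

namespace Literature.NumberTheory.Automorphic.UnitaryGroup

variable (E : Type) [Field E] [NumberField E] (n : ℕ)

/-- **`(1, reindex e₂ (g ⊕ 1)) = reindex e₂ ((1, g) ⊕ 1)` in `GL_{n+n}(𝔸_E)`**: the embedding `GL(𝔸_E^∞) → GL(𝔸_E)`,
`h ↦ (1, h)` commutes with `g ↦ reindex e₂ e₂ (g ⊕ 1)` (entrywise: `(δ_{ab}, ·)` on both sides) — the finite-adelic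
`U(𝕍) × 1 ⊂ H` inside the adelic one. [cite: GelbartRogawski1991, §3.1 Prop. 3.1.1 p. 455 L1–3] -/
theorem ofFinite_reindexGL_blockDiagGL_one (g : GL (Fin n) (FiniteAdeleRing (𝓞 E) E)) :
    GLn.ofFinite (n + n) E (reindexGL (finSumFinEquiv (m := n) (n := n)) (blockDiagGL (g, 1))) =
      reindexGL (finSumFinEquiv (m := n) (n := n)) (blockDiagGL (GLn.ofFinite n E g, 1)) := by
  refine Units.ext (Matrix.ext fun a b => ?_)
  obtain ⟨a, rfl⟩ := (finSumFinEquiv (m := n) (n := n)).surjective a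
  obtain ⟨b, rfl⟩ := (finSumFinEquiv (m := n) (n := n)).surjective b
  rw [GLn.coe_ofFinite_apply]
  simp only [coe_reindexGL, Matrix.reindex_apply, Matrix.submatrix_apply, Equiv.symm_apply_apply, coe_blockDiagGL]
  have h1 : (1 : Matrix (Fin (n + n)) (Fin (n + n)) (InfiniteAdeleRing E)) (finSumFinEquiv a) (finSumFinEquiv b) =
      (1 : Matrix (Fin n ⊕ Fin n) (Fin n ⊕ Fin n) (InfiniteAdeleRing E)) a b := by
    simp only [Matrix.one_apply, EmbeddingLike.apply_eq_iff_eq]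
  rw [h1]
  rcases a with i | i <;> rcases b with j | j
  · rw [Matrix.fromBlocks_apply₁₁, Matrix.fromBlocks_apply₁₁, GLn.coe_ofFinite_apply]
    simp only [Matrix.one_apply, Sum.inl.injEq]
  · rw [Matrix.fromBlocks_apply₁₂, Matrix.fromBlocks_apply₁₂, Matrix.zero_apply, Matrix.zero_apply]
    simp only [Matrix.one_apply, reduceCtorEq, if_false]
    rfl
  · rw [Matrix.fromBlocks_apply₂₁, Matrix.fromBlocks_apply₂₁, Matrix.zero_apply, Matrix.zero_apply]
    simp only [Matrix.one_apply, reduceCtorEq, if_false]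
    rfl
  · rw [Matrix.fromBlocks_apply₂₂, Matrix.fromBlocks_apply₂₂, Units.val_one, Units.val_one]
    simp only [Matrix.one_apply, Sum.inr.injEq]
    by_cases hij : i = j
    · simp only [hij, if_true]; rfl
    · simp only [hij, if_false]; rfl

end Literature.NumberTheory.Automorphic.UnitaryGroup

/-! ## §1 `U(J)(𝔸_{F,f}) →* U(J^𝔻)(𝔸_{F,f})`, `g ↦ g ⊕ 1` -/

namespace Literature.NumberTheory.GelbartRogawski1991.UnitaryDualPair.LocalSplitting

variable (F : Type) [Field F] [NumberField F] (E : Type) [Field E] [NumberField E] [Algebra F E] (c : E ≃ₐ[F] E)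
  (n : ℕ) {T₀ : Matrix (Fin n) (Fin n) F}
  {J : Matrix (Fin n) (Fin n) E} (hJ : J = T₀.map (algebraMap F E))
  {JD : Matrix (Fin (n + n)) (Fin (n + n)) E} (hJD : JD = (gramD F n T₀).map (algebraMap F E))

omit [NumberField F] in
include hJ hJD in
/-- **the finite-adelic form of `J^𝔻` is the re-enumerated block form** `reindex e₂ e₂ (J ⊗ 1 ⊕ (−T₀) ⊗ 1)` over `𝔸_E^∞`.
[cite: HarrisKudlaSweet1996, §1 (1.9)] -/
theorem finiteAdelicForm_doubled_eq :
    UnitaryGroup.finiteAdelicForm E (n + n) JD =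
      Matrix.reindex (e₂ n) (e₂ n) (Matrix.fromBlocks (UnitaryGroup.finiteAdelicForm E n J) 0 0
        (((-T₀).map (algebraMap F E)).map (algebraMap E (FiniteAdeleRing (𝓞 E) E)))) := by
  subst hJ hJD
  unfold UnitaryGroup.finiteAdelicForm
  rw [UnitaryGroup.reindex_map, UnitaryGroup.fromBlocks_diag_map, UnitaryGroup.reindex_map,
    UnitaryGroup.fromBlocks_diag_map]

omit [NumberField F] in
include hJ hJD in
/-- **`U(J)(𝔸_{F,f}) →* U(J^𝔻)(𝔸_{F,f})`, `g ↦ g ⊕ 1`** on the finite-adelic points (matrix `reindex e₂ e₂ (g ⊕ 1)` in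
`GL_{n+n}(𝔸_E^∞)`; membership by `reindexGL_mem_iff` and `blockDiagGL_mem` along `finiteAdelicForm_doubled_eq`) — the
finite-adelic companion of the local `inlLoc` and of the adelic `GRConstruction.inlG`.
[cite: GelbartRogawski1991, §3.1 Prop. 3.1.1 p. 455 L1–3] -/
def inlFin : UnitaryGroup.finAdelic F E c n J →* UnitaryGroup.finAdelic F E c (n + n) JD :=
  ((UnitaryGroup.reindexGL (e₂ n)).comp (UnitaryGroup.blockDiagGL.comp
    ((UnitaryGroup.finAdelic F E c n J).subtype.prod 1))).codRestrict _ fun g => by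
      change UnitaryGroup.reindexGL (e₂ n)
          (UnitaryGroup.blockDiagGL ((g : GL (Fin n) (FiniteAdeleRing (𝓞 E) E)), 1)) ∈
        unitaryGroupOfForm (UnitaryGroup.conjFiniteAdele F E c) (UnitaryGroup.finiteAdelicForm E (n + n) JD)
      rw [finiteAdelicForm_doubled_eq F E n hJ hJD, UnitaryGroup.reindexGL_mem_iff]
      exact UnitaryGroup.blockDiagGL_mem _ g.2 (one_mem _)

omit [NumberField F] in
/-- matrix of `inlFin g`: `reindex e₂ e₂ (g ⊕ 1)`. [cite: GelbartRogawski1991, §3.1 Prop. 3.1.1 p. 455 L1–3] -/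
@[simp] theorem coe_inlFin (g : UnitaryGroup.finAdelic F E c n J) :
    ((inlFin F E c n hJ hJD g : UnitaryGroup.finAdelic F E c (n + n) JD) : GL (Fin (n + n)) (FiniteAdeleRing (𝓞 E) E)) =
      UnitaryGroup.reindexGL (e₂ n) (UnitaryGroup.blockDiagGL ((g : GL (Fin n) (FiniteAdeleRing (𝓞 E) E)), 1)) :=
  rfl

omit [NumberField F] in
/-- `inlFin` is continuous. [cite: GelbartRogawski1991, §3.1 Prop. 3.1.1 p. 455 L1–3] -/
theorem continuous_inlFin : Continuous (inlFin F E c n hJ hJD) := by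
  refine Continuous.subtype_mk ?_ _
  exact (UnitaryGroup.continuous_reindexGL (e₂ n)).comp
    (UnitaryGroup.continuous_blockDiagGL.comp (continuous_subtype_val.prodMk continuous_const))

omit [NumberField F] in
/-- `inlFin` is injective. [cite: GelbartRogawski1991, §3.1 Prop. 3.1.1 p. 455 L1–3] -/
theorem inlFin_injective : Function.Injective (inlFin F E c n hJ hJD) := fun g g' h => by
  have h1 := congrArg (fun x : UnitaryGroup.finAdelic F E c (n + n) JD => (x : GL (Fin (n + n)) (FiniteAdeleRing (𝓞 E) E))) h
  simp only [coe_inlFin] at h1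
  exact Subtype.ext (Prod.mk.inj (UnitaryGroup.blockDiagGL_injective (UnitaryGroup.reindexGL_injective _ h1))).1

/-- **`(1, g ⊕ 1) = (1, g) ⊕ 1` in `GL_{n+n}(𝔸_E)`**: the adelic matrix of `inlFin g` is `reindex e₂ e₂ ((1, g) ⊕ 1)`
(`ofFinite_reindexGL_blockDiagGL_one` on the unitary points). [cite: GelbartRogawski1991, §3.1 Prop. 3.1.1 p. 455 L1–3] -/
theorem adelicVal_finAdelicToAdelic_inlFin (g : UnitaryGroup.finAdelic F E c n J) :
    UnitaryGroup.adelicVal F E c (n + n) JD (UnitaryGroup.finAdelicToAdelic F E c (n + n) JD (inlFin F E c n hJ hJD g)) =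
      UnitaryGroup.reindexGL (e₂ n) (UnitaryGroup.blockDiagGL
        (UnitaryGroup.adelicVal F E c n J (UnitaryGroup.finAdelicToAdelic F E c n J g), 1)) :=
  UnitaryGroup.ofFinite_reindexGL_blockDiagGL_one E n (g : GL (Fin n) (FiniteAdeleRing (𝓞 E) E))

/-! ## §2 Local components: `(g ⊕ 1)_v = g_v ⊕ 1` -/

/-- **the `v`-component of `inlFin g` is `inlLoc v` of the `v`-component of `g`**: `evalPlace v (inlFin g) = inlLoc v (evalPlace v g)`
in `U(J^𝔻)(F_v) ≤ Π_{w ∣ v} GL_{n+n}(E_w)` (both sides have `w`-component `reindex e₂ e₂ (g_w ⊕ 1)`).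
[cite: GelbartRogawski1991, §3.1 Prop. 3.1.1 p. 455 L1–3] -/
theorem evalPlace_inlFin (v : HeightOneSpectrum (𝓞 F)) (g : UnitaryGroup.finAdelic F E c n J) :
    UnitaryGroup.evalPlace F E c (n + n) JD v (inlFin F E c n hJ hJD g) =
      inlLoc F E c v n hJ hJD (UnitaryGroup.evalPlace F E c n J v g) := by
  refine Subtype.ext (funext fun w => Units.ext ?_)
  -- left: `GL(eval_w) (reindex e₂ (g ⊕ 1)) = reindex e₂ (GL(eval_w) g ⊕ 1)`
  have hL : ((UnitaryGroup.evalPlace F E c (n + n) JD v (inlFin F E c n hJ hJD g) : UnitaryGroup.localPi E c (n + n) JD v) :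
        UnitaryGroup.LocalGLPi E (n + n) v) w =
      UnitaryGroup.reindexGL (e₂ n) (UnitaryGroup.blockDiagGL
        (GLn.evalAt n E w.1 (g : GL (Fin n) (FiniteAdeleRing (𝓞 E) E)), 1)) := by
    change GLn.evalAt (n + n) E w.1 (UnitaryGroup.reindexGL (e₂ n)
      (UnitaryGroup.blockDiagGL ((g : GL (Fin n) (FiniteAdeleRing (𝓞 E) E)), 1))) = _
    unfold GLn.evalAt
    rw [UnitaryGroup.map_reindexGL, UnitaryGroup.map_blockDiagGL, map_one]
  -- right: the `w`-component of `GLn.piEquiv (reindex e₂ (piEquiv⁻¹ (g_w)_w ⊕ 1))`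
  have hR : (((inlLoc F E c v n hJ hJD (UnitaryGroup.evalPlace F E c n J v g) : UnitaryGroup.localPi E c (n + n) JD v) :
        UnitaryGroup.LocalGLPi E (n + n) v) w : Matrix (Fin (n + n)) (Fin (n + n)) (w.1.adicCompletion E)) =
      ((UnitaryGroup.reindexGL (e₂ n) (UnitaryGroup.blockDiagGL
        ((UnitaryGroup.localGLPiEquiv E n v).symm
          ((UnitaryGroup.evalPlace F E c n J v g : UnitaryGroup.localPi E c n J v) : UnitaryGroup.LocalGLPi E n v), 1)) :
          GL (Fin (n + n)) (UnitaryGroup.LocalRing E v)) : Matrix (Fin (n + n)) (Fin (n + n)) (UnitaryGroup.LocalRing E v)).map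
        (Pi.evalRingHom (fun w : UnitaryGroup.PlacesOver E v => w.1.adicCompletion E) w) := by
    rfl
  rw [hL, hR]
  change _ = ((Matrix.GeneralLinearGroup.map (Pi.evalRingHom (fun w : UnitaryGroup.PlacesOver E v => w.1.adicCompletion E) w)
    (UnitaryGroup.reindexGL (e₂ n) (UnitaryGroup.blockDiagGL
      ((UnitaryGroup.localGLPiEquiv E n v).symm
        ((UnitaryGroup.evalPlace F E c n J v g : UnitaryGroup.localPi E c n J v) : UnitaryGroup.LocalGLPi E n v), 1))) :
      GL (Fin (n + n)) (w.1.adicCompletion E)) : Matrix (Fin (n + n)) (Fin (n + n)) (w.1.adicCompletion E))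
  rw [UnitaryGroup.map_reindexGL, UnitaryGroup.map_blockDiagGL, map_one]
  rfl

/-- `g ⊕ 1` is integral at `v` when `g` is: `(inlFin g)_v ∈ U(J^𝔻)(𝒪_v)` for `g_v ∈ U(J)(𝒪_v)` (`inlLoc_mem_localInt`).
[cite: GelbartRogawski1991, §3.1 (3.1.3) p. 456] -/
theorem evalPlace_inlFin_mem_localInt (v : HeightOneSpectrum (𝓞 F)) {g : UnitaryGroup.finAdelic F E c n J}
    (hg : UnitaryGroup.evalPlace F E c n J v g ∈ UnitaryGroup.localInt E c n J v) :
    UnitaryGroup.evalPlace F E c (n + n) JD v (inlFin F E c n hJ hJD g) ∈ UnitaryGroup.localInt E c (n + n) JD v := by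
  rw [evalPlace_inlFin]
  exact inlLoc_mem_localInt F E c v n hJ hJD hg

/-- `g ⊕ 1 ∈ K_f⁰(J^𝔻) = ∏_v U(J^𝔻)(𝒪_v)` for `g ∈ K_f⁰(J) = ∏_v U(J)(𝒪_v)` (the integral levels of
`UnitaryGroupRestrictedProduct`, factorwise by `mem_finAdelicIntegralLevel_iff_forall`). [cite: PlatonovRapinchuk1994, §5.1] -/
theorem inlFin_mem_finAdelicIntegralLevel {g : UnitaryGroup.finAdelic F E c n J}
    (hg : g ∈ UnitaryGroup.finAdelicIntegralLevel F E c n J) :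
    inlFin F E c n hJ hJD g ∈ UnitaryGroup.finAdelicIntegralLevel F E c (n + n) JD := by
  rw [UnitaryGroup.mem_finAdelicIntegralLevel_iff_forall] at hg ⊢
  exact fun v => evalPlace_inlFin_mem_localInt F E c n hJ hJD v (hg v)

end Literature.NumberTheory.GelbartRogawski1991.UnitaryDualPair.LocalSplitting


/-! ## §3 The CM datum: `inlG (a(1,k) · b(1,u)) = (1, inlFin (finPairEmb (k, u)))` in `H(𝔸)` -/

namespace Literature.NumberTheory.GelbartRogawski1991.GRConstruction

open UnitaryDualPair UnitaryDualPair.LocalSplitting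

variable (L : Type) [Field L] [NumberField L] [IsCMField L]

variable {N M n : ℕ} (e : Fin N × Fin M ≃ Fin n)
  (dV : Fin N → L) (hdV : ∀ i, IsCMField.complexConj L (dV i) = dV i)
  (dW : Fin M → L) (hdW : ∀ i, IsCMField.complexConj L (dW i) = dW i)

/-- **`inlG (a(1,k) · b(1,u)) = (1, inlFin (finPairEmb (k, u)))` in `H(𝔸) = U(J^𝔻)(𝔸_{L⁺})`**: the element of the doubled
group at which the undoubled pair splitting `pairSmall₁ (undoubleHom sD …) ∘ finPairToAdelic` evaluates `sD` on a
finite-adelic pair `(k, u)` is the image of the finite-adelic doubled element `inlFin (reindex e (k ⊗ u))` — so that, for an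
`sD` assembled from an archimedean and a finite half, `sD (inlG (a(1,k) · b(1,u))) = s_f (inlFin (finPairEmb (k, u)))`.
Matrix identity in `GL_{n+n}(𝔸_L)`: `coe_inlG`, `finAdelicToAdelic_finPairEmb`, `ofFinite_reindexGL_blockDiagGL_one`.
[cite: GelbartRogawski1991, §3.1 Prop. 3.1.1 p. 455 L1–3] -/
theorem inlG_adelicInl_mul_adelicInr_finAdelicToAdelic
    (k : UnitaryGroup.finAdelic (Fp L) L (IsCMField.complexConj L) N (Matrix.diagonal dV))
    (u : UnitaryGroup.finAdelic (Fp L) L (IsCMField.complexConj L) M (Matrix.diagonal dW)) :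
    inlG L e dV hdV dW hdW
        (UnitaryGroup.adelicInl (Fp L) L (IsCMField.complexConj L) N M (Matrix.diagonal dV) (Matrix.diagonal dW)
            (UnitaryGroup.finAdelicToAdelic (Fp L) L (IsCMField.complexConj L) N (Matrix.diagonal dV) k) *
          UnitaryGroup.adelicInr (Fp L) L (IsCMField.complexConj L) N M (Matrix.diagonal dV) (Matrix.diagonal dW)
            (UnitaryGroup.finAdelicToAdelic (Fp L) L (IsCMField.complexConj L) M (Matrix.diagonal dW) u)) =
      UnitaryGroup.finAdelicToAdelic (Fp L) L (IsCMField.complexConj L) (n + n) (hermD L e dV hdV dW hdW)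
        (inlFin (Fp L) L (IsCMField.complexConj L) n
          (reindex_kronecker_eq_gram_map (Fp L) L e (realDiagonal_map L dV hdV).symm (realDiagonal_map L dW hdW).symm)
          (hermD_eq_map_gramD L e dV hdV dW hdW)
          (UnitaryGroup.finPairEmb (Fp L) L (IsCMField.complexConj L) N M e (Matrix.diagonal dV) (Matrix.diagonal dW) (k, u))) := by
  refine Subtype.ext ?_
  -- `a(1,k) · b(1,u) = dualPair ((1,k), (1,u))`
  have hpair : UnitaryGroup.adelicInl (Fp L) L (IsCMField.complexConj L) N M (Matrix.diagonal dV) (Matrix.diagonal dW)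
        (UnitaryGroup.finAdelicToAdelic (Fp L) L (IsCMField.complexConj L) N (Matrix.diagonal dV) k) *
      UnitaryGroup.adelicInr (Fp L) L (IsCMField.complexConj L) N M (Matrix.diagonal dV) (Matrix.diagonal dW)
        (UnitaryGroup.finAdelicToAdelic (Fp L) L (IsCMField.complexConj L) M (Matrix.diagonal dW) u) =
      UnitaryGroup.dualPair (UnitaryGroup.conjAdele (Fp L) L (IsCMField.complexConj L))
        (UnitaryGroup.adelicForm L N (Matrix.diagonal dV)) (UnitaryGroup.adelicForm L M (Matrix.diagonal dW))
        ((UnitaryGroup.finAdelicToAdelic (Fp L) L (IsCMField.complexConj L) N (Matrix.diagonal dV) k :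
            UnitaryGroup.adelic (Fp L) L (IsCMField.complexConj L) N (Matrix.diagonal dV)),
          (UnitaryGroup.finAdelicToAdelic (Fp L) L (IsCMField.complexConj L) M (Matrix.diagonal dW) u :
            UnitaryGroup.adelic (Fp L) L (IsCMField.complexConj L) M (Matrix.diagonal dW))) := by
    rw [← UnitaryGroup.noncommCoprod_adelicInl_adelicInr]
    rfl
  rw [hpair]
  -- both sides as matrices in `GL_{n+n}(𝔸_L)`: `reindex e₂ (reindex e ((1,k) ⊗ (1,u)) ⊕ 1)` vs `(1, reindex e₂ (reindex e (k ⊗ u) ⊕ 1))`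
  change UnitaryGroup.reindexGL (e₂ (n := n)) (UnitaryGroup.blockDiagGL (UnitaryGroup.reindexGL e
      (UnitaryGroup.kroneckerGL (GLn.ofFinite N L (k : GL (Fin N) (FiniteAdeleRing (𝓞 L) L)),
        GLn.ofFinite M L (u : GL (Fin M) (FiniteAdeleRing (𝓞 L) L)))), 1)) =
    GLn.ofFinite (n + n) L (UnitaryGroup.reindexGL (LocalSplitting.e₂ n) (UnitaryGroup.blockDiagGL
      (UnitaryGroup.reindexGL e (UnitaryGroup.kroneckerGL ((k : GL (Fin N) (FiniteAdeleRing (𝓞 L) L)),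
        (u : GL (Fin M) (FiniteAdeleRing (𝓞 L) L)))), 1)))
  rw [UnitaryGroup.ofFinite_reindexGL_blockDiagGL_one, UnitaryGroup.ofFinite_reindexGL_kroneckerGL]

/-! ## §4 Along an assembled doubled splitting: `sD (inlG (a(1,k) · b(1,u))) = s_f (inlFin (finPairEmb (k, u)))` -/

section Assembled

variable (hdV0 : ∀ i, dV i ≠ 0) (hdW0 : ∀ i, dW i ≠ 0) {χ : Literature.NumberTheory.GaloisRepresentations.HeckeCharacter L}
  {sf : UnitaryGroup.finAdelic (Fp L) L (IsCMField.complexConj L) (n + n) (hermD L e dV hdV dW hdW) →* MpD L e dV hdV dW hdW}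
  {sa : UnitaryGroup.arch (Fp L) L (IsCMField.complexConj L) (n + n) (hermD L e dV hdV dW hdW) →* MpD L e dV hdV dW hdW}

/-- **the assembled splitting on finite-adelic points is the finite half**: `assemble hf ha (1, g_f) = s_f g_f`
(`(1, g_f)_∞ = 1`, `(1, g_f)_f = g_f`). [cite: HarrisKudlaSweet1996, §1 (1.11)–(1.16)] -/
theorem assemble_finAdelicToAdelic (hf : IsFinHalf L e dV hdV hdV0 dW hdW hdW0 χ sf) (ha : IsArchHalf L e dV hdV hdV0 dW hdW hdW0 χ sa)
    (g : UnitaryGroup.finAdelic (Fp L) L (IsCMField.complexConj L) (n + n) (hermD L e dV hdV dW hdW)) :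
    assemble L e dV hdV hdV0 dW hdW hdW0 hf ha
        (UnitaryGroup.finAdelicToAdelic (Fp L) L (IsCMField.complexConj L) (n + n) (hermD L e dV hdV dW hdW) g) = sf g := by
  have h1 : assemble L e dV hdV hdV0 dW hdW hdW0 hf ha
        (UnitaryGroup.finAdelicToAdelic (Fp L) L (IsCMField.complexConj L) (n + n) (hermD L e dV hdV dW hdW) g) =
      sa (UnitaryGroup.archPart (Fp L) L (IsCMField.complexConj L) (n + n) (hermD L e dV hdV dW hdW)
          (UnitaryGroup.finAdelicToAdelic (Fp L) L (IsCMField.complexConj L) (n + n) (hermD L e dV hdV dW hdW) g)) *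
        sf (UnitaryGroup.finPart (Fp L) L (IsCMField.complexConj L) (n + n) (hermD L e dV hdV dW hdW)
          (UnitaryGroup.finAdelicToAdelic (Fp L) L (IsCMField.complexConj L) (n + n) (hermD L e dV hdV dW hdW) g)) := by
    unfold assemble
    rfl
  have h2 := UnitaryGroup.archPart_finAdelicToAdelic (Fp L) L (IsCMField.complexConj L) (n + n) (hermD L e dV hdV dW hdW) g
  have h3 := UnitaryGroup.finPart_finAdelicToAdelic (Fp L) L (IsCMField.complexConj L) (n + n) (hermD L e dV hdV dW hdW) g
  have h4 : sa 1 = 1 := map_one sa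
  exact h1.trans ((congrArg₂ (fun a b => sa a * sf b) h2 h3).trans ((congrArg (· * sf g) h4).trans (one_mul (sf g))))

/-- **(H3-L2) along an assembled `sD = sa · sf`: `sD (inlG (a(1,k) · b(1,u))) = s_f (inlFin (finPairEmb (k, u)))`** — the
doubled splitting, read at the element of `H(𝔸)` where the undoubled pair splitting is evaluated on a finite-adelic pair, IS
its finite half at the finite-adelic doubled element `reindex e₂ (reindex e (k ⊗ u) ⊕ 1)`
(`inlG_adelicInl_mul_adelicInr_finAdelicToAdelic` + `assemble_finAdelicToAdelic`).
[cite: GelbartRogawski1991, §3.1 Prop. 3.1.1 p. 455 L1–3] -/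
theorem assemble_inlG_adelicInl_mul_adelicInr (hf : IsFinHalf L e dV hdV hdV0 dW hdW hdW0 χ sf)
    (ha : IsArchHalf L e dV hdV hdV0 dW hdW hdW0 χ sa)
    (k : UnitaryGroup.finAdelic (Fp L) L (IsCMField.complexConj L) N (Matrix.diagonal dV))
    (u : UnitaryGroup.finAdelic (Fp L) L (IsCMField.complexConj L) M (Matrix.diagonal dW)) :
    assemble L e dV hdV hdV0 dW hdW hdW0 hf ha (inlG L e dV hdV dW hdW
        (UnitaryGroup.adelicInl (Fp L) L (IsCMField.complexConj L) N M (Matrix.diagonal dV) (Matrix.diagonal dW)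
            (UnitaryGroup.finAdelicToAdelic (Fp L) L (IsCMField.complexConj L) N (Matrix.diagonal dV) k) *
          UnitaryGroup.adelicInr (Fp L) L (IsCMField.complexConj L) N M (Matrix.diagonal dV) (Matrix.diagonal dW)
            (UnitaryGroup.finAdelicToAdelic (Fp L) L (IsCMField.complexConj L) M (Matrix.diagonal dW) u))) =
      sf (inlFin (Fp L) L (IsCMField.complexConj L) n
          (reindex_kronecker_eq_gram_map (Fp L) L e (realDiagonal_map L dV hdV).symm (realDiagonal_map L dW hdW).symm)
          (hermD_eq_map_gramD L e dV hdV dW hdW)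
          (UnitaryGroup.finPairEmb (Fp L) L (IsCMField.complexConj L) N M e (Matrix.diagonal dV) (Matrix.diagonal dW) (k, u))) := by
  exact (congrArg (assemble L e dV hdV hdV0 dW hdW hdW0 hf ha)
    (inlG_adelicInl_mul_adelicInr_finAdelicToAdelic L e dV hdV dW hdW k u)).trans
      (assemble_finAdelicToAdelic L e dV hdV dW hdW hdV0 hdW0 hf ha _)

end Assembled

end Literature.NumberTheory.GelbartRogawski1991.GRConstruction

end
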